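/-
SKELETON for crux item stmt-PneNP-18538 (`StrongComposition`, C1) — line `lrx-gluing` (the rung C1|LRX_t), lead g2
(prover-lead-stmt-PneNP-18538-g2), brief director-frontier g17 INBOX l.183 (2)(b).  Crux directory:
Summits/PneNP/PneNP/Cruxes/StrongComposition/.  Register with
`ledger skeleton check Lines/lrx_gluing.lean --crux stmt-PneNP-18538 --crux-decl
Summit.PneNP.PneNP.Cruxes.StrongComposition.LrxGluing.StrongCompositionLRX`.
FRONTIER rung of the KRW programme; nothing here bears on P vs NP.
-/
import Mathlib
import Summits.PneNP.PneNP.Theorems.KrwChromaticSteeringStrongCompositionLrbRung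
import Summits.PneNP.PneNP.Theorems.KrwChromaticSteeringStrongCompositionLradRouteLink
import Literature.Computability.Complexity.KRWComposition

/-!
# Line `lrx-gluing`: the rung C1|LRX — strong composition on the classes `LRX_t`, loss `c (log₂ mn + 1) + t`

Target (registered with `--crux-decl`): `StrongCompositionLRX` — C1 (`Theses.KrwChromaticSteering.StrongComposition`) with
its loss relaxed by the CROSSING BUDGET `t`, for protocols that are `LRXDisciplined g t` (landed class of
`Theorems/…LrbClassDefs.lean`: node tests = label ∨ affine ∨ single-row tests, rows typed online with loads; an affine test MAY
now pass through rows already cut by single-row tests — «type-A» nodes — its crossing weight being the number of such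
(combinatorial) rows it meets, total weight `≤ t` on every root–leaf path).  `LRX_0 = LRB`, so at `t = 0` this is the PROVED rung
C1|LRB (`KrwLrb.strongCompositionLRB`, p718994) and below it the PROVED rung C1|LRAD; C1 implies the rung (`lrx_of_strongComposition`).
What the rung does NOT reach (director (c), lead g1 (ii)): the `t`-free bound on LRA (unbounded crossing weight) — that needs the
(BANK) invariant of p4 g21/g22 — and C1 itself (all protocols), which stays OPEN.

THE PROOF (memo `LensBarrierP4g20.md` §3 ¶1 / §3.5: «eager decoupling with label kills pays `w + 1` per type-A node»; the
planner's (L4) in the docstring of `P4g20X.LRXQuantitative`): the glued LRAD invariant `KrwLrad.InvAt g q τ N` (potential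
`ℓ + min K k ≤ depth + 2`) is kept VERBATIM and evaluated on PADDED trees — `InvAt g q τ (pad t N)` is exactly «potential
`≤ depth N + 2 + t`», and `InvAt` sees a tree only through its play function and its depth (`invAt_of_run_depth`).  Induction
`invAt_pad_of_lrx` over `LRXDisciplinedOn g t τ N`: leaf / label / single-row (incl. type B via the landed `KrwLrb.transferB`)
exactly as the landed `KrwLrb.invAt_of_lrx`; a type-A node of weight `w` (affine support `U` meeting the combinatorial rows
`i₁ … i_w`) is replaced by its DECOUPLING TREE `decoupleA/B` — `w` single-row PARITY tests `X ↦ ⊕_{j ∈ U ∩ row iₖ} X_{iₖ j}`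
followed, on each of the `2^w` branches, by the affine test on the stripped support `U ∖ rows {i₁…i_w}` with the constant corrected
by the branch — which has the SAME play function as the node (`parityOn_split`) and depth `+ w`; on it the invariant follows from
the landed LRAD step lemmas alone (`row_stepAt_*` `w` times on combinatorial rows, then `affine_stepAt_*` on a support avoiding
combinatorial rows), and `proj ∘ retagX U = retag (U ∖ comb rows) ∘ proj`.  The budget bookkeeping `(t − w) + w + 1` is the depth
of the padded decoupling tree.  Root (`E = []`, `k = K = q`): `ℓ + q ≤ depth + t + 2` (`lrx_rect_bound`), so `C = 1`.

Contents: §1 vocabulary (imported); §2 the rung and the load-bearing statement `LRXQuantitative` (both VERBATIM the planner's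
`P4g20X.StrongCompositionLRX` / `P4g20X.LRXQuantitative`, `Cruxes/StrongComposition/NextRungP4g20.lean`, over the landed
vocabulary); §2b the two REGISTERED STUB STATEMENTS `CrossingStepAlice` / `CrossingStepBob` (the type-A step, over the landed
vocabulary only); §3 padding and `invAt_of_run_depth`; §4 decoupling trees; §5 the type-A step PROVED and the stubs
`stub_crossingAlice` / `stub_crossingBob` closed; §6 the adversary theorem `invAt_pad_of_lrx`, the root bound,
`lrxQuantitative_holds : LRXQuantitative` (`C = 1`); §7 composition `assembly_of_quantitative` + `StrongCompositionLRX_of`; §8 links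
(C1 ⟹ rung ⟹ LRB rung ⟹ LRAD rung); §9 non-vacuity.
-/

set_option linter.dupNamespace false
set_option autoImplicit false

namespace Summit.PneNP.PneNP.Cruxes.StrongComposition.LrxGluing

open Literature.Computability.Complexity
open Summit.PneNP.PneNP.Theorems.KrwLrad
open Summit.PneNP.PneNP.Theorems.KrwLrb

universe u

/-! ## §1 Vocabulary — IMPORTED from the landed modules (nothing re-declared)
`Theorems.KrwLrad` (`…LradDefs.lean` p711344): `Hard`, `parityOn`, `rowParity`, `rowSupp`, `offRow`, `eqRows`, `touchedRows`,
`retag`, `RowType`, `AffGeneric`, `PerRowLU`, `InvAt`, …; `Theorems.KrwLrb` (`…LrbDefs.lean` p713896, `…LrbClassDefs.lean`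
p717758): `SubspaceHard`, `jointSubspaceHard_exists`, `RowTypeX`, `affWeight`, `retagX`, `NodeOKX`, `LRXDisciplinedOn`,
`LRXDisciplined`, `LRBDisciplined`, `RowTypeX.proj`. -/

example : (LRBDisciplined : ((Fin 2 → Bool) → Bool) → KWTree (Fin 3 × Fin 2) → Prop)
    = fun g P => LRXDisciplined g 0 P := rfl

/-! ## §2 Target and the load-bearing statement (VERBATIM `P4g20X`, over the landed vocabulary) -/

/-- [verbatim `P4g20X.StrongCompositionLRX`] **the registered target: rung C1|LRX** — strong composition with loss
`c (log₂ (m n) + 1) + t` for every `LRX_t` protocol. -/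
def StrongCompositionLRX : Prop :=
  ∃ c : ℕ, ∀ m n : ℕ, 1 ≤ n → ∀ f : (Fin m → Bool) → Bool, (∃ a b, f a ≠ f b) →
    ∃ g : (Fin n → Bool) → Bool, ∀ (t : ℕ) (P : KWTree (Fin m × Fin n)),
      LRXDisciplined g t P → P.SolvesStrong f g →
      ∃ Q : KWTree (Fin m), Q.Solves f ∧ Q.depth + n ≤ P.depth + c * (Nat.log 2 (m * n) + 1) + t

/-- [verbatim `P4g20X.LRXQuantitative`] **the load-bearing statement** (PROVED below, `lrxQuantitative_holds`, `C = 1`): for a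
non-constant outer `f` with `ℓ`-hard KW rectangle and an inner `g` that is `r`-affine-generic and subspace-hard with budget
`q ≥ 1`, `q + r + 1 ≤ n`, every `LRX_t` protocol for `KW_f ⊛ KW_g` has depth `≥ ℓ + (q − 1) − C − t`. -/
def LRXQuantitative : Prop :=
  ∃ C : ℕ, ∀ (m n q r ℓ t : ℕ) (f : (Fin m → Bool) → Bool) (g : (Fin n → Bool) → Bool),
    (∃ a b, f a = true ∧ f b = false) →
    AffGeneric g r → q + r + 1 ≤ n → SubspaceHard g q → 1 ≤ q →
    Hard (f ⁻¹' {true}) (f ⁻¹' {false}) ℓ →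
    ∀ P : KWTree (Fin m × Fin n), LRXDisciplined g t P → P.SolvesStrong f g →
      ℓ + (q - 1) ≤ P.depth + C + t

/-! ## §2b The two REGISTERED STUB STATEMENTS (the type-A step), packaged as `Prop`s over the landed vocabulary

At an affine test `s = c ⊕ parityOn U` of crossing weight `w = affWeight U τ` (the number of COMBINATORIAL rows the support `U`
meets at the LRX typing `τ`): if both subtrees satisfy the glued LRAD invariant `KrwLrad.InvAt` at the projection of the retyped
typing `retagX U τ`, then EVERY tree `N` with the node's play function and depth `≥ depth (node) + w` satisfies `InvAt` at the
projection of `τ` — «one unit of potential per combinatorial row crossed» (memo `LensBarrierP4g20.md` §3 ¶1, §3.5; the planner's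
(L4) «decoupling step: an M3 row step with an affine `ψ`, then an LRAD affine step»).  `N` is universally quantified with a
play/depth interface so that the statements mention no new object (the proof instantiates `N := pad t (node)`, §3). -/

/-- **Stub statement A — the type-A step, Alice node.** -/
def CrossingStepAlice : Prop :=
  ∀ (m n q : ℕ) (g : (Fin n → Bool) → Bool), PerRowLU g m q → ∀ (i₀ : Fin m) (j₀ : Fin n) (τ : Fin m → RowTypeX)
    (s : (Fin m × Fin n → Bool) → Bool) (P Q N : KWTree (Fin m × Fin n)) (U : Finset (Fin m × Fin n)) (c : Bool),
    (∀ X, s X = Bool.xor c (parityOn U X)) →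
    InvAt g q (fun i => (retagX U τ i).proj) P → InvAt g q (fun i => (retagX U τ i).proj) Q →
    (∀ X Y, N.run X Y = (KWTree.alice s P Q).run X Y) →
    (KWTree.alice s P Q).depth + affWeight U τ ≤ N.depth →
    InvAt g q (fun i => (τ i).proj) N

/-- **Stub statement B — the type-A step, Bob node** (mirror image). -/
def CrossingStepBob : Prop :=
  ∀ (m n q : ℕ) (g : (Fin n → Bool) → Bool), PerRowLU g m q → ∀ (i₀ : Fin m) (j₀ : Fin n) (τ : Fin m → RowTypeX)
    (s : (Fin m × Fin n → Bool) → Bool) (P Q N : KWTree (Fin m × Fin n)) (U : Finset (Fin m × Fin n)) (c : Bool),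
    (∀ Y, s Y = Bool.xor c (parityOn U Y)) →
    InvAt g q (fun i => (retagX U τ i).proj) P → InvAt g q (fun i => (retagX U τ i).proj) Q →
    (∀ X Y, N.run X Y = (KWTree.bob s P Q).run X Y) →
    (KWTree.bob s P Q).depth + affWeight U τ ≤ N.depth →
    InvAt g q (fun i => (τ i).proj) N

/-! ## §3 Padding: the invariant with a shifted potential is the invariant on a padded tree -/

section Padding

variable {m n : ℕ} {g : (Fin n → Bool) → Bool} {q : ℕ}

/-- `pad t N`: `t` dummy Alice nodes (constant bit, both subtrees `N`) on top of `N` — same play, depth `+ t`. -/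
def pad {ι : Type u} : ℕ → KWTree ι → KWTree ι
  | 0, N => N
  | t + 1, N => KWTree.alice (fun _ => false) (pad t N) (pad t N)

/-- Padding does not change the play. -/
@[simp] theorem run_pad {ι : Type u} : ∀ (t : ℕ) (N : KWTree ι) (a b : ι → Bool), (pad t N).run a b = N.run a b
  | 0, _, _, _ => rfl
  | t + 1, N, a, b => by simp only [pad, KWTree.run_alice, run_pad t N a b, ite_self]

/-- Padding adds `t` to the depth. -/
@[simp] theorem depth_pad {ι : Type u} : ∀ (t : ℕ) (N : KWTree ι), (pad t N).depth = N.depth + t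
  | 0, _ => rfl
  | t + 1, N => by simp only [pad, KWTree.depth_alice, depth_pad t N, max_self]; omega

/-- **`InvAt` sees a tree only through its play function and (monotonically) its depth.** -/
theorem invAt_of_run_depth {τ : Fin m → RowType} {N N' : KWTree (Fin m × Fin n)}
    (hrun : ∀ X Y, N'.run X Y = N.run X Y) (hd : N.depth ≤ N'.depth) (h : InvAt g q τ N) :
    InvAt g q τ N' := by
  intro A B S T E k hst hsat hload hV hD hneA hneB ℓ K r hL hR hK
  have hV' : ValidOnE g N A B S T E := by
    intro X hX Y hY
    have h1 := hV X hX Y hY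
    rwa [hrun X Y] at h1
  have := h A B S T E k hst hsat hload hV' hD hneA hneB ℓ K r hL hR hK
  omega

/-- Depth bookkeeping of a padded Alice node: children padded by `t − w`, plus the `w` extra rounds, is the node padded by `t`. -/
theorem depth_alice_pad_add {ι : Type u} (s : (ι → Bool) → Bool) (P Q : KWTree ι) {t w : ℕ} (hw : w ≤ t) :
    (KWTree.alice s (pad (t - w) P) (pad (t - w) Q)).depth + w = (pad t (KWTree.alice s P Q)).depth := by
  simp only [KWTree.depth_alice, depth_pad]
  rw [max_add_add_right]
  omega

/-- Depth bookkeeping of a padded Bob node. -/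
theorem depth_bob_pad_add {ι : Type u} (s : (ι → Bool) → Bool) (P Q : KWTree ι) {t w : ℕ} (hw : w ≤ t) :
    (KWTree.bob s (pad (t - w) P) (pad (t - w) Q)).depth + w = (pad t (KWTree.bob s P Q)).depth := by
  simp only [KWTree.depth_bob, depth_pad]
  rw [max_add_add_right]
  omega

end Padding

/-! ## §4 Decoupling trees of a type-A node -/

section Decoupling

variable {m n : ℕ} {g : (Fin n → Bool) → Bool} {q : ℕ}

/-- Strip the rows of a list from a support, innermost first (the supports met along the decoupling tree). -/
def strip : List (Fin m) → Finset (Fin m × Fin n) → Finset (Fin m × Fin n)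
  | [], U => U
  | i :: rows, U => strip rows (offRow U i)

/-- Membership in a stripped support. -/
theorem mem_strip : ∀ (rows : List (Fin m)) (U : Finset (Fin m × Fin n)) (p : Fin m × Fin n),
    p ∈ strip rows U ↔ p ∈ U ∧ p.1 ∉ rows
  | [], U, p => by simp [strip]
  | i :: rows, U, p => by
    rw [strip, mem_strip rows (offRow U i) p]
    simp only [offRow, Finset.mem_filter, List.mem_cons, not_or]
    tauto

/-- The rows a stripped support touches. -/
theorem mem_touchedRows_strip (rows : List (Fin m)) (U : Finset (Fin m × Fin n)) (i : Fin m) :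
    i ∈ touchedRows (strip rows U) ↔ i ∈ eqRows U ∧ i ∉ rows := by
  simp only [touchedRows, eqRows, Finset.mem_image, mem_strip, Prod.exists, exists_and_right, exists_eq_right]

/-- **Alice's decoupling tree** of the affine test `X ↦ c ⊕ parityOn U X` along the rows `rows`: single-row PARITY tests on the
listed rows (`X ↦ ⊕_{(i,j) ∈ U} X_{ij}` for the head row `i`), then — on each branch — the affine test on the stripped support with
the constant corrected by the parities answered on the branch; subtrees `P` (bit `false`) and `Q` (bit `true`) at the bottom. -/
def decoupleA (P Q : KWTree (Fin m × Fin n)) :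
    List (Fin m) → Finset (Fin m × Fin n) → Bool → KWTree (Fin m × Fin n)
  | [], U, c => KWTree.alice (fun X => Bool.xor c (parityOn U X)) P Q
  | i :: rows, U, c => KWTree.alice (fun X => rowParity (rowSupp U i) (row X i))
      (decoupleA P Q rows (offRow U i) c) (decoupleA P Q rows (offRow U i) (!c))

/-- **Bob's decoupling tree** (mirror image: the tests read Bob's matrix). -/
def decoupleB (P Q : KWTree (Fin m × Fin n)) :
    List (Fin m) → Finset (Fin m × Fin n) → Bool → KWTree (Fin m × Fin n)
  | [], U, c => KWTree.bob (fun Y => Bool.xor c (parityOn U Y)) P Q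
  | i :: rows, U, c => KWTree.bob (fun Y => rowParity (rowSupp U i) (row Y i))
      (decoupleB P Q rows (offRow U i) c) (decoupleB P Q rows (offRow U i) (!c))

/-- The decoupling tree plays exactly like the affine node (`parityOn_split` along the listed rows). -/
theorem run_decoupleA (P Q : KWTree (Fin m × Fin n)) :
    ∀ (rows : List (Fin m)) (U : Finset (Fin m × Fin n)) (c : Bool) (X Y : Fin m × Fin n → Bool),
      (decoupleA P Q rows U c).run X Y = if Bool.xor c (parityOn U X) then Q.run X Y else P.run X Y
  | [], _, _, _, _ => rfl
  | i :: rows, U, c, X, Y => by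
    simp only [decoupleA, KWTree.run_alice, run_decoupleA P Q rows]
    rw [parityOn_split U X i]
    cases rowParity (rowSupp U i) (row X i) <;> cases c <;> cases parityOn (offRow U i) X <;> rfl

/-- Bob's decoupling tree plays exactly like the affine node. -/
theorem run_decoupleB (P Q : KWTree (Fin m × Fin n)) :
    ∀ (rows : List (Fin m)) (U : Finset (Fin m × Fin n)) (c : Bool) (X Y : Fin m × Fin n → Bool),
      (decoupleB P Q rows U c).run X Y = if Bool.xor c (parityOn U Y) then Q.run X Y else P.run X Y
  | [], _, _, _, _ => rfl
  | i :: rows, U, c, X, Y => by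
    simp only [decoupleB, KWTree.run_bob, run_decoupleB P Q rows]
    rw [parityOn_split U Y i]
    cases rowParity (rowSupp U i) (row Y i) <;> cases c <;> cases parityOn (offRow U i) Y <;> rfl

/-- Depth of Alice's decoupling tree: the node's depth plus one round per listed row. -/
theorem depth_decoupleA (P Q : KWTree (Fin m × Fin n)) :
    ∀ (rows : List (Fin m)) (U : Finset (Fin m × Fin n)) (c : Bool),
      (decoupleA P Q rows U c).depth = max P.depth Q.depth + 1 + rows.length
  | [], _, _ => rfl
  | i :: rows, U, c => by
    simp only [decoupleA, KWTree.depth_alice, depth_decoupleA P Q rows, max_self, List.length_cons]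
    omega

/-- Depth of Bob's decoupling tree. -/
theorem depth_decoupleB (P Q : KWTree (Fin m × Fin n)) :
    ∀ (rows : List (Fin m)) (U : Finset (Fin m × Fin n)) (c : Bool),
      (decoupleB P Q rows U c).depth = max P.depth Q.depth + 1 + rows.length
  | [], _, _ => rfl
  | i :: rows, U, c => by
    simp only [decoupleB, KWTree.depth_bob, depth_decoupleB P Q rows, max_self, List.length_cons]
    omega

/-- **The invariant on Alice's decoupling tree**, from the landed LRAD step lemmas alone: `row_stepAt_alice` once per listed
(combinatorial) row — the typing does not move — then `affine_stepAt_alice` on the stripped support, which avoids combinatorial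
rows. -/
theorem invAt_decoupleA (hLU : PerRowLU g m q) (i₀ : Fin m) (j₀ : Fin n) (τ : Fin m → RowType)
    {P Q : KWTree (Fin m × Fin n)} :
    ∀ (rows : List (Fin m)) (U : Finset (Fin m × Fin n)) (c : Bool),
      (∀ i ∈ rows, τ i = RowType.combinatorial) →
      (∀ i ∈ touchedRows (strip rows U), τ i ≠ RowType.combinatorial) →
      InvAt g q (retag (strip rows U) τ) P → InvAt g q (retag (strip rows U) τ) Q →
      InvAt g q τ (decoupleA P Q rows U c)
  | [], U, c, _, hU, hIP, hIQ =>
    affine_stepAt_alice hLU (s := fun X => Bool.xor c (parityOn U X)) (fun _ => rfl) hU hIP hIQ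
  | i :: rows, U, c, hrows, hU, hIP, hIQ => by
    have hτi : τ i = RowType.combinatorial := hrows i List.mem_cons_self
    have hrows' : ∀ i' ∈ rows, τ i' = RowType.combinatorial := fun i' hi' => hrows i' (List.mem_cons_of_mem i hi')
    have h0 := invAt_decoupleA hLU i₀ j₀ τ rows (offRow U i) c hrows' hU hIP hIQ
    have h1 := invAt_decoupleA hLU i₀ j₀ τ rows (offRow U i) (!c) hrows' hU hIP hIQ
    have hup : Function.update τ i RowType.combinatorial = τ := Function.update_eq_self_iff.2 hτi.symm
    refine row_stepAt_alice i₀ j₀ (i := i) (ψ := rowParity (rowSupp U i)) (fun _ => rfl) ?_ ?_ ?_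
    · rw [hτi]; exact fun h => RowType.noConfusion h
    · rw [hup]; exact h0
    · rw [hup]; exact h1

/-- **The invariant on Bob's decoupling tree** (mirror image). -/
theorem invAt_decoupleB (hLU : PerRowLU g m q) (i₀ : Fin m) (j₀ : Fin n) (τ : Fin m → RowType)
    {P Q : KWTree (Fin m × Fin n)} :
    ∀ (rows : List (Fin m)) (U : Finset (Fin m × Fin n)) (c : Bool),
      (∀ i ∈ rows, τ i = RowType.combinatorial) →
      (∀ i ∈ touchedRows (strip rows U), τ i ≠ RowType.combinatorial) →
      InvAt g q (retag (strip rows U) τ) P → InvAt g q (retag (strip rows U) τ) Q →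
      InvAt g q τ (decoupleB P Q rows U c)
  | [], U, c, _, hU, hIP, hIQ =>
    affine_stepAt_bob hLU (s := fun Y => Bool.xor c (parityOn U Y)) (fun _ => rfl) hU hIP hIQ
  | i :: rows, U, c, hrows, hU, hIP, hIQ => by
    have hτi : τ i = RowType.combinatorial := hrows i List.mem_cons_self
    have hrows' : ∀ i' ∈ rows, τ i' = RowType.combinatorial := fun i' hi' => hrows i' (List.mem_cons_of_mem i hi')
    have h0 := invAt_decoupleB hLU i₀ j₀ τ rows (offRow U i) c hrows' hU hIP hIQ
    have h1 := invAt_decoupleB hLU i₀ j₀ τ rows (offRow U i) (!c) hrows' hU hIP hIQ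
    have hup : Function.update τ i RowType.combinatorial = τ := Function.update_eq_self_iff.2 hτi.symm
    refine row_stepAt_bob i₀ j₀ (i := i) (ψ := rowParity (rowSupp U i)) (fun _ => rfl) ?_ ?_ ?_
    · rw [hτi]; exact fun h => RowType.noConfusion h
    · rw [hup]; exact h0
    · rw [hup]; exact h1

/-- The combinatorial rows an affine support meets, listed (its length is the crossing weight `affWeight U τ`). -/
noncomputable def combRows (U : Finset (Fin m × Fin n)) (τ : Fin m → RowTypeX) : List (Fin m) :=
  ((eqRows U).filter fun i => τ i = RowTypeX.combinatorial).toList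

theorem mem_combRows {U : Finset (Fin m × Fin n)} {τ : Fin m → RowTypeX} {i : Fin m} :
    i ∈ combRows U τ ↔ i ∈ eqRows U ∧ τ i = RowTypeX.combinatorial := by
  simp [combRows]

theorem length_combRows (U : Finset (Fin m × Fin n)) (τ : Fin m → RowTypeX) :
    (combRows U τ).length = affWeight U τ := by
  simp [combRows, affWeight, Finset.length_toList]

/-- Every listed row is combinatorial (in the LRAD projection of the typing). -/
theorem proj_of_mem_combRows {U : Finset (Fin m × Fin n)} {τ : Fin m → RowTypeX} :
    ∀ i ∈ combRows U τ, (τ i).proj = RowType.combinatorial := by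
  intro i hi
  rw [(mem_combRows.1 hi).2]
  rfl

/-- The stripped support avoids combinatorial rows. -/
theorem proj_ne_of_touched_strip {U : Finset (Fin m × Fin n)} {τ : Fin m → RowTypeX} :
    ∀ i ∈ touchedRows (strip (combRows U τ) U), (τ i).proj ≠ RowType.combinatorial := by
  intro i hi hc
  rw [mem_touchedRows_strip, mem_combRows] at hi
  exact hi.2 ⟨hi.1, (proj_eq_combinatorial_iff _).1 hc⟩

/-- **Retyping commutes with forgetting loads** at a type-A node: LRAD-retyping the projected typing by the STRIPPED support is
the projection of the LRX-retyping by the full support (combinatorial rows stay combinatorial on both sides). -/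
theorem retag_strip_eq_proj_retagX (U : Finset (Fin m × Fin n)) (τ : Fin m → RowTypeX) :
    retag (strip (combRows U τ) U) (fun i => (τ i).proj) = fun i => (retagX U τ i).proj := by
  funext i
  by_cases h1 : i ∈ eqRows U
  · by_cases h2 : τ i = RowTypeX.combinatorial
    · have hni : i ∉ touchedRows (strip (combRows U τ) U) := by
        rw [mem_touchedRows_strip, mem_combRows]; exact fun h => h.2 ⟨h1, h2⟩
      simp [retag, retagX, hni, h1, h2, RowTypeX.proj]
    · have hi : i ∈ touchedRows (strip (combRows U τ) U) := by
        rw [mem_touchedRows_strip, mem_combRows]; exact ⟨h1, fun h => h2 h.2⟩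
      simp [retag, retagX, hi, h1, h2, RowTypeX.proj]
  · have hni : i ∉ touchedRows (strip (combRows U τ) U) := by
      rw [mem_touchedRows_strip]; exact fun h => h1 h.1
    simp [retag, retagX, hni, h1]

end Decoupling

/-! ## §5 The type-A step PROVED (`crossingStep_alice/bob`) and the two REGISTERED STUBS closed by it

At an affine test of crossing weight `w = affWeight U τ`, the invariant of the two subtrees at the retyped typing gives the
invariant of ANY tree `N` playing like the node and at least `w` deeper — the «one unit per combinatorial row crossed» of the eager
decoupling — by the decoupling trees of §4.  The registered stubs `stub_crossingAlice : CrossingStepAlice` /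
`stub_crossingBob : CrossingStepBob` (§2b) are these lemmas with explicit binders. -/

section Stubs

variable {m n : ℕ} {g : (Fin n → Bool) → Bool} {q : ℕ}

/-- **The type-A step, Alice.**  For an Alice affine test `s = c ⊕ parityOn U` at the LRX typing `τ`: if both subtrees satisfy the
glued LRAD invariant `InvAt` at the projection of the retyped typing `retagX U τ`, then every tree `N` with the node's play function
and depth `≥ depth (alice s P Q) + affWeight U τ` satisfies `InvAt` at the projection of `τ`.  Proof: transport (`invAt_of_run_depth`)
from Alice's decoupling tree along the listed combinatorial rows `combRows U τ` (`invAt_decoupleA`, `run_decoupleA`,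
`depth_decoupleA`, `retag_strip_eq_proj_retagX`). -/
theorem crossingStep_alice (hLU : PerRowLU g m q) (i₀ : Fin m) (j₀ : Fin n) {τ : Fin m → RowTypeX}
    {s : (Fin m × Fin n → Bool) → Bool} {P Q N : KWTree (Fin m × Fin n)} {U : Finset (Fin m × Fin n)} {c : Bool}
    (hs : ∀ X, s X = Bool.xor c (parityOn U X))
    (hIP : InvAt g q (fun i => (retagX U τ i).proj) P) (hIQ : InvAt g q (fun i => (retagX U τ i).proj) Q)
    (hrun : ∀ X Y, N.run X Y = (KWTree.alice s P Q).run X Y)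
    (hdepth : (KWTree.alice s P Q).depth + affWeight U τ ≤ N.depth) :
    InvAt g q (fun i => (τ i).proj) N := by
  rw [← retag_strip_eq_proj_retagX U τ] at hIP hIQ
  have hV := invAt_decoupleA hLU i₀ j₀ (fun i => (τ i).proj) (combRows U τ) U c
    proj_of_mem_combRows proj_ne_of_touched_strip hIP hIQ
  refine invAt_of_run_depth (fun X Y => ?_) ?_ hV
  · rw [hrun, run_decoupleA, KWTree.run_alice, hs X]
  · rw [depth_decoupleA, length_combRows]
    simpa only [KWTree.depth_alice] using hdepth

/-- **The type-A step, Bob** (mirror image of `crossingStep_alice`). -/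
theorem crossingStep_bob (hLU : PerRowLU g m q) (i₀ : Fin m) (j₀ : Fin n) {τ : Fin m → RowTypeX}
    {s : (Fin m × Fin n → Bool) → Bool} {P Q N : KWTree (Fin m × Fin n)} {U : Finset (Fin m × Fin n)} {c : Bool}
    (hs : ∀ Y, s Y = Bool.xor c (parityOn U Y))
    (hIP : InvAt g q (fun i => (retagX U τ i).proj) P) (hIQ : InvAt g q (fun i => (retagX U τ i).proj) Q)
    (hrun : ∀ X Y, N.run X Y = (KWTree.bob s P Q).run X Y)
    (hdepth : (KWTree.bob s P Q).depth + affWeight U τ ≤ N.depth) :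
    InvAt g q (fun i => (τ i).proj) N := by
  rw [← retag_strip_eq_proj_retagX U τ] at hIP hIQ
  have hV := invAt_decoupleB hLU i₀ j₀ (fun i => (τ i).proj) (combRows U τ) U c
    proj_of_mem_combRows proj_ne_of_touched_strip hIP hIQ
  refine invAt_of_run_depth (fun X Y => ?_) ?_ hV
  · rw [hrun, run_decoupleB, KWTree.run_bob, hs Y]
  · rw [depth_decoupleB, length_combRows]
    simpa only [KWTree.depth_bob] using hdepth

/-- **STUB A (registered): the type-A step, Alice — PROVED** (`crossingStep_alice`). -/
theorem stub_crossingAlice : CrossingStepAlice :=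
  fun _ _ _ _ hLU i₀ j₀ _ _ _ _ _ _ _ hs hIP hIQ hrun hdepth => crossingStep_alice hLU i₀ j₀ hs hIP hIQ hrun hdepth

/-- **STUB B (registered): the type-A step, Bob — PROVED** (`crossingStep_bob`). -/
theorem stub_crossingBob : CrossingStepBob :=
  fun _ _ _ _ hLU i₀ j₀ _ _ _ _ _ _ _ hs hIP hIQ hrun hdepth => crossingStep_bob hLU i₀ j₀ hs hIP hIQ hrun hdepth

end Stubs

/-! ## §6 The adversary theorem on `LRX_t`, the root bound, `LRXQuantitative` PROVED -/

section Main

variable {m n : ℕ} {g : (Fin n → Bool) → Bool} {q r : ℕ}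

/-- **The adversary theorem for `LRX_t`**: every subtree `N` that is `LRX_t`-disciplined from the typing `τ` satisfies the glued
LRAD invariant at the projection of `τ` ON THE PADDED TREE `pad t N` (potential `ℓ + min K k ≤ depth N + 2 + t`).  Leaf, label
test, single-row test (incl. type B via `transferB`) as in the landed `KrwLrb.invAt_of_lrx`, transported along `pad` by
`invAt_of_run_depth`; affine test of weight `w ≤ t` by the type-A step (§5) with `N := pad t (node)`, the subtrees padded by
`t − w`. -/
theorem invAt_pad_of_lrx (hgen : AffGeneric g r) (hqr : q + r + 1 ≤ n) (hsub : SubspaceHard g q)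
    (hLU : PerRowLU g m q) (i₀ : Fin m) (j₀ : Fin n) :
    ∀ (N : KWTree (Fin m × Fin n)) (t : ℕ) (τ : Fin m → RowTypeX), LRXDisciplinedOn g t τ N →
      InvAt g q (fun i => (τ i).proj) (pad t N)
  | .leaf p, t, τ, _ => invAt_of_run_depth (run_pad t _) (by simp) (inv_leafAt hLU p _)
  | .alice s P Q, t, τ, h => by
    obtain ⟨τ', w, hN, hw, hP, hQ⟩ := h
    have ihP := invAt_pad_of_lrx hgen hqr hsub hLU i₀ j₀ P (t - w) τ' hP
    have ihQ := invAt_pad_of_lrx hgen hqr hsub hLU i₀ j₀ Q (t - w) τ' hQ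
    have hrun : ∀ X Y, (pad t (KWTree.alice s P Q)).run X Y
        = (KWTree.alice s (pad (t - w) P) (pad (t - w) Q)).run X Y := fun X Y => by
      simp only [run_pad, KWTree.run_alice]
    have hd : (KWTree.alice s (pad (t - w) P) (pad (t - w) Q)).depth + w
        = (pad t (KWTree.alice s P Q)).depth := depth_alice_pad_add s P Q hw
    rcases hN with ⟨⟨φ, hφ⟩, hτ', hw0⟩ | ⟨U, c, hs, hτ', hW⟩ | ⟨i, ψ, hs, hτ', hw0⟩
    · subst hτ'
      exact invAt_of_run_depth hrun (by omega) (label_stepAt_alice i₀ hφ ihP ihQ)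
    · subst hτ'
      exact stub_crossingAlice m n q g hLU i₀ j₀ τ s _ _ _ U c hs ihP ihQ hrun (by rw [← hW]; omega)
    · subst hτ'
      rw [proj_update_combinatorial] at ihP ihQ
      refine invAt_of_run_depth hrun (by omega) ?_
      by_cases hτi : (τ i).proj = RowType.algebraic
      · refine transferB hgen hqr hsub (τ := fun i' => (τ i').proj) hτi ?_
        refine row_stepAt_alice i₀ j₀ hs (by simp) ?_ ?_
        · rwa [Function.update_idem]
        · rwa [Function.update_idem]
      · exact row_stepAt_alice i₀ j₀ hs hτi ihP ihQ
  | .bob s P Q, t, τ, h => by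
    obtain ⟨τ', w, hN, hw, hP, hQ⟩ := h
    have ihP := invAt_pad_of_lrx hgen hqr hsub hLU i₀ j₀ P (t - w) τ' hP
    have ihQ := invAt_pad_of_lrx hgen hqr hsub hLU i₀ j₀ Q (t - w) τ' hQ
    have hrun : ∀ X Y, (pad t (KWTree.bob s P Q)).run X Y
        = (KWTree.bob s (pad (t - w) P) (pad (t - w) Q)).run X Y := fun X Y => by
      simp only [run_pad, KWTree.run_bob]
    have hd : (KWTree.bob s (pad (t - w) P) (pad (t - w) Q)).depth + w
        = (pad t (KWTree.bob s P Q)).depth := depth_bob_pad_add s P Q hw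
    rcases hN with ⟨⟨φ, hφ⟩, hτ', hw0⟩ | ⟨U, c, hs, hτ', hW⟩ | ⟨i, ψ, hs, hτ', hw0⟩
    · subst hτ'
      exact invAt_of_run_depth hrun (by omega) (label_stepAt_bob i₀ hφ ihP ihQ)
    · subst hτ'
      exact stub_crossingBob m n q g hLU i₀ j₀ τ s _ _ _ U c hs ihP ihQ hrun (by rw [← hW]; omega)
    · subst hτ'
      rw [proj_update_combinatorial] at ihP ihQ
      refine invAt_of_run_depth hrun (by omega) ?_
      by_cases hτi : (τ i).proj = RowType.algebraic
      · refine transferB hgen hqr hsub (τ := fun i' => (τ i').proj) hτi ?_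
        refine row_stepAt_bob i₀ j₀ hs (by simp) ?_ ?_
        · rwa [Function.update_idem]
        · rwa [Function.update_idem]
      · exact row_stepAt_bob i₀ j₀ hs hτi ihP ihQ

/-- **Root lemma** (the root state of the glued adversary, as in the landed `KrwLrb.lrb_rect_bound`, for ANY tree `N` playing like
the protocol `P`): if `N` satisfies the invariant at the all-fresh typing then `ℓ + q ≤ depth N + 2`. -/
theorem rect_bound_of_invAt {f : (Fin m → Bool) → Bool} {ℓ : ℕ} (hf : ∃ a b, f a = true ∧ f b = false)
    (hgen : AffGeneric g r) (hqr : q + r + 1 ≤ n) (hsub : SubspaceHard g q) (hq : 1 ≤ q)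
    (hH : Hard (f ⁻¹' {true}) (f ⁻¹' {false}) ℓ) {P N : KWTree (Fin m × Fin n)}
    (hrunN : ∀ X Y, N.run X Y = P.run X Y) (hsol : P.SolvesStrong f g)
    (hI : InvAt g q (fun _ => RowType.fresh) N) : ℓ + q ≤ N.depth + 2 := by
  classical
  -- `m ≥ 1` (f non-constant) and a coordinate `i₀`; `n ≥ 1` and a coordinate `j₀`
  obtain ⟨a₁, b₁, hfa₁, hfb₁⟩ := hf
  have hm : 0 < m := by
    rcases Nat.eq_zero_or_pos m with h0 | h0
    · exfalso
      subst h0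
      have : a₁ = b₁ := funext fun i => i.elim0
      rw [this, hfb₁] at hfa₁
      exact Bool.false_ne_true hfa₁
    · exact h0
  let i₀ : Fin m := ⟨0, hm⟩
  let j₀ : Fin n := ⟨0, by omega⟩
  -- the row game of `g` itself is `q`-hard (subspace-hardness on the empty system); `g` takes both values
  have hKW : Hard {x | (∀ e ∈ ([] : List (Finset (Fin n) × Bool)), rowParity e.1 x = e.2) ∧ g x = true}
      {x | (∀ e ∈ ([] : List (Finset (Fin n) × Bool)), rowParity e.1 x = e.2) ∧ g x = false} q := by
    simpa using hsub [] (by simp) ⟨fun _ => false, by simp⟩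
  have hsetα : ∀ α : Bool, {x | (∀ e ∈ ([] : List (Finset (Fin n) × Bool)), rowParity e.1 x = e.2) ∧ g x = α}
      = RA g (fun _ : Fin m => (Set.univ : Set (Fin n → Bool))) i₀ α := by
    intro α; ext x; simp [RA]
  obtain ⟨u, hu⟩ := hKW.nonempty_left hq j₀
  obtain ⟨v, hv⟩ := hKW.nonempty_right hq j₀
  have hgu : g u = true := by simpa using hu
  have hgv : g v = false := by simpa using hv
  have hgα : ∀ α : Bool, ∃ x, g x = α := fun α => by cases α; exacts [⟨v, hgv⟩, ⟨u, hgu⟩]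
  -- per-row label-universality with budget `q ≤ n - r - 1`
  have hLU : PerRowLU g m q :=
    perRowLU_mono (by omega) (perRowLUOfGeneric_holds m n r g ⟨u, v, hgu, hgv⟩ hgen)
  -- the root state
  let U : Fin m → Set (Fin n → Bool) := fun _ => Set.univ
  set A : Set (Fin m → Bool) := f ⁻¹' {true} with hA
  set B : Set (Fin m → Bool) := f ⁻¹' {false} with hB
  have hAE_A : AE g A U = A := AE_root hgα A
  have hAE_B : AE g B U = B := AE_root hgα B
  have hst : StateOK (fun _ : Fin m => RowType.fresh) U U ([] : AffSys m n) := fun i =>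
    ⟨fun _ => rowLoad_nil i, fun _ => ⟨rfl, rfl⟩⟩
  have hsat0 : ∃ X, Sat ([] : AffSys m n) X := ⟨fun _ => false, fun e he => by simp at he⟩
  have hload : ∀ i, rowLoad ([] : AffSys m n) i + q ≤ q := fun i => by rw [rowLoad_nil, Nat.zero_add]
  have hV : ValidOnE g N A B U U [] := by
    intro X hX Y hY
    have hX1 : f (rowLabels g X) = true := by simpa [hA] using hX.1
    have hY1 : f (rowLabels g Y) = false := by simpa [hB] using hY.1
    rw [hrunN X Y]
    exact hsol X Y (by rw [blockComp_apply]; exact hX1) (by rw [blockComp_apply]; exact hY1)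
  have hD : ∀ a ∈ AE g A U, ∀ b ∈ AE g B U, a ≠ b := by
    rw [hAE_A, hAE_B]
    rintro a ha b hb rfl
    have ha' : f a = true := by simpa [hA] using ha
    have hb' : f a = false := by simpa [hB] using hb
    rw [ha'] at hb'
    exact Bool.noConfusion hb'
  have hneA : (AE g A U).Nonempty := by rw [hAE_A]; exact ⟨a₁, by simpa [hA] using hfa₁⟩
  have hneB : (AE g B U).Nonempty := by rw [hAE_B]; exact ⟨b₁, by simpa [hB] using hfb₁⟩
  have hL : Hard (AE g A U) (AE g B U) ℓ := by rw [hAE_A, hAE_B]; exact hH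
  have hR : ∀ i α, Alive g A B U U i α → Hard (RA g U i α) (RA g U i (!α)) q := by
    intro i α _
    have hi : ∀ β, RA g U i β = RA g U i₀ β := fun β => rfl
    rw [hi, hi, ← hsetα, ← hsetα]
    cases α
    · exact hard_swap hKW
    · exact hKW
  have hK : ∀ i α, Alive g A B U U i α → q ≤ q + cst (AE g A U) i + cst (AE g B U) i :=
    fun _ _ _ => by omega
  have hmain := hI A B U U [] q hst hsat0 hload hV hD hneA hneB ℓ q (fun _ _ => q) hL hR hK
  rwa [Nat.min_self] at hmain

/-- **The glued adversary bound on `LRX_t`, sharp form**: `ℓ + q ≤ depth + t + 2` for every `LRX_t` protocol for `KW_f ⊛ KW_g`,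
`f` non-constant with `ℓ`-hard KW rectangle, `g` `r`-affine-generic and subspace-hard with budget `q ≥ 1`, `q + r + 1 ≤ n`. -/
theorem lrx_rect_bound {f : (Fin m → Bool) → Bool} {ℓ : ℕ} (hf : ∃ a b, f a = true ∧ f b = false)
    (hgen : AffGeneric g r) (hqr : q + r + 1 ≤ n) (hsub : SubspaceHard g q) (hq : 1 ≤ q)
    (hH : Hard (f ⁻¹' {true}) (f ⁻¹' {false}) ℓ) {t : ℕ} {P : KWTree (Fin m × Fin n)} (hP : LRXDisciplined g t P)
    (hsol : P.SolvesStrong f g) : ℓ + q ≤ P.depth + t + 2 := by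
  classical
  obtain ⟨a₁, b₁, hfa₁, hfb₁⟩ := hf
  have hm : 0 < m := by
    rcases Nat.eq_zero_or_pos m with h0 | h0
    · exfalso
      subst h0
      have : a₁ = b₁ := funext fun i => i.elim0
      rw [this, hfb₁] at hfa₁
      exact Bool.false_ne_true hfa₁
    · exact h0
  let i₀ : Fin m := ⟨0, hm⟩
  let j₀ : Fin n := ⟨0, by omega⟩
  -- `g` takes both values (subspace-hardness on the empty system), so per-row label-universality holds with budget `q`
  have hKW : Hard {x | (∀ e ∈ ([] : List (Finset (Fin n) × Bool)), rowParity e.1 x = e.2) ∧ g x = true}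
      {x | (∀ e ∈ ([] : List (Finset (Fin n) × Bool)), rowParity e.1 x = e.2) ∧ g x = false} q := by
    simpa using hsub [] (by simp) ⟨fun _ => false, by simp⟩
  obtain ⟨u, hu⟩ := hKW.nonempty_left hq j₀
  obtain ⟨v, hv⟩ := hKW.nonempty_right hq j₀
  have hgu : g u = true := by simpa using hu
  have hgv : g v = false := by simpa using hv
  have hLU : PerRowLU g m q :=
    perRowLU_mono (by omega) (perRowLUOfGeneric_holds m n r g ⟨u, v, hgu, hgv⟩ hgen)
  have hI := invAt_pad_of_lrx hgen hqr hsub hLU i₀ j₀ P t (fun _ => RowTypeX.fresh) hP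
  have h := rect_bound_of_invAt ⟨a₁, b₁, hfa₁, hfb₁⟩ hgen hqr hsub hq hH (run_pad t P) hsol hI
  rw [depth_pad] at h
  omega

/-- **`LRXQuantitative` PROVED** (constant `C = 1`), from the sharp form `lrx_rect_bound`. -/
theorem lrxQuantitative_holds : LRXQuantitative := by
  refine ⟨1, ?_⟩
  intro m n q r ℓ t f g hf hgen hqr hsub hq hH P hP hsol
  have h := lrx_rect_bound hf hgen hqr hsub hq hH hP hsol
  omega

/-- KRW form of the bound: from any `LRX_t` protocol `P` for `KW_f ⊛ KW_g` (`f` non-constant, `g` `r`-generic and subspace-hard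
with budget `q ≥ 1`, `q + r + 1 ≤ n`) a `KW_f` protocol `Q` with `Q.depth + q ≤ P.depth + t + 2`. -/
theorem exists_solves_of_lrxDisciplined {f : (Fin m → Bool) → Bool} (hf : ∃ a b, f a ≠ f b)
    (hgen : AffGeneric g r) (hqr : q + r + 1 ≤ n) (hsub : SubspaceHard g q) (hq : 1 ≤ q)
    {t : ℕ} {P : KWTree (Fin m × Fin n)} (hP : LRXDisciplined g t P) (hsol : P.SolvesStrong f g) :
    ∃ Q : KWTree (Fin m), Q.Solves f ∧ Q.depth + q ≤ P.depth + t + 2 := by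
  classical
  have hne : ∃ a b, f a = true ∧ f b = false := by
    obtain ⟨a, b, hab⟩ := hf
    cases ha : f a <;> cases hb : f b
    · rw [ha, hb] at hab; exact absurd rfl hab
    · exact ⟨b, a, hb, ha⟩
    · exact ⟨a, b, ha, hb⟩
    · rw [ha, hb] at hab; exact absurd rfl hab
  by_contra hcon
  push Not at hcon
  set ℓ := P.depth + t + 3 - q with hℓ
  have hH : Hard (f ⁻¹' {true}) (f ⁻¹' {false}) ℓ := by
    intro Q hQ
    have hs : Q.Solves f := fun a b ha hb => hQ a (by simpa using ha) b (by simpa using hb)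
    have := hcon Q hs
    omega
  have hmain := lrx_rect_bound hne hgen hqr hsub hq hH hP hsol
  omega

end Main

/-! ## §7 Composition (kernel-checked): S0⁺ (LANDED, `KrwLrb.stub_jointSubspaceHard` p715652) and `LRXQuantitative` give the rung -/

section Assembly

/-- **Assembly of the rung** from S0⁺ and the adversary bound ALONE, loss `(c + C + 2) (log₂ (m n) + 1) + t` where `c` is the
constant of S0⁺ and `C` the additive constant of `LRXQuantitative` (the LRB assembly `KrwLrb.strongCompositionLRB_of_quantitative`
with the budget `t` carried through).  Large `n` (`c (log₂ n + 1) + 2 ≤ n`, so `q = n − r − 1 ≥ 1`, `r = c (log₂ n + 1)`): S0⁺'s `g`,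
the bound in contrapositive form; tiny `n`: a dictator `g` and the `liftRows` embedding already fit. -/
theorem assembly_of_quantitative (h0 : jointSubspaceHard_exists) (hQ : LRXQuantitative) :
    ∃ c : ℕ, ∀ m n : ℕ, 1 ≤ n → ∀ f : (Fin m → Bool) → Bool, (∃ a b, f a ≠ f b) →
      ∃ g : (Fin n → Bool) → Bool, ∀ (t : ℕ) (P : KWTree (Fin m × Fin n)),
        LRXDisciplined g t P → P.SolvesStrong f g →
        ∃ Q : KWTree (Fin m), Q.Solves f ∧ Q.depth + n ≤ P.depth + c * (Nat.log 2 (m * n) + 1) + t := by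
  obtain ⟨c, hc⟩ := h0
  obtain ⟨C, hQ⟩ := hQ
  refine ⟨c + C + 2, fun m n hn f hf => ?_⟩
  have hne : ∃ a b, f a = true ∧ f b = false := by
    obtain ⟨a, b, hab⟩ := hf
    cases ha : f a <;> cases hb : f b
    · rw [ha, hb] at hab; exact absurd rfl hab
    · exact ⟨b, a, hb, ha⟩
    · exact ⟨a, b, ha, hb⟩
    · rw [ha, hb] at hab; exact absurd rfl hab
  have hm : 0 < m := by
    obtain ⟨a, b, hab⟩ := hf
    rcases Nat.eq_zero_or_pos m with h0 | h0
    · exfalso; subst h0; exact hab (congrArg f (funext fun i => i.elim0))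
    · exact h0
  set L := Nat.log 2 (m * n) + 1 with hL
  have hLn : Nat.log 2 n + 1 ≤ L := by
    have : Nat.log 2 n ≤ Nat.log 2 (m * n) := Nat.log_mono_right (Nat.le_mul_of_pos_left n hm)
    omega
  set r := c * (Nat.log 2 n + 1) with hr
  have hcL : r ≤ c * L := Nat.mul_le_mul_left _ hLn
  have hCL : C ≤ C * L := Nat.le_mul_of_pos_right C (by omega)
  have e1 : (c + C + 2) * L = c * L + C * L + 2 * L := by ring
  by_cases hbig : r + 2 ≤ n
  · -- large `n`: S0⁺'s inner function, budget `q = n - r - 1 ≥ 1`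
    obtain ⟨g, hgen, hsub⟩ := hc n (by omega)
    refine ⟨g, fun t P hP hsol => ?_⟩
    set q := n - r - 1 with hq
    have hq1 : 1 ≤ q := by omega
    have hqn : q + r + 1 ≤ n := by omega
    by_contra hcon
    push Not at hcon
    set ℓ := P.depth + (c + C + 2) * L + t + 1 - n with hℓ
    have hH : Hard (f ⁻¹' {true}) (f ⁻¹' {false}) ℓ := by
      intro Q hQs
      have hs : Q.Solves f := fun a b ha hb => hQs a (by simpa using ha) b (by simpa using hb)
      have := hcon Q hs
      omega
    have hmain := hQ m n q r ℓ t f g hne hgen hqn hsub hq1 hH P hP hsol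
    omega
  · -- tiny `n` (`n ≤ r + 1 ≤ c L + 1`): a dictator and the `liftRows` protocol
    refine ⟨fun x => x ⟨0, by omega⟩, fun t P hP hsol => ?_⟩
    refine ⟨P.comap (KWTree.liftRows (fun _ => true) (fun _ => false))
        (KWTree.liftRows (fun _ => true) (fun _ => false)) Prod.fst,
      KWTree.solves_comap_liftRows hsol rfl rfl, ?_⟩
    rw [KWTree.depth_comap]
    omega

/-- **The skeleton's concluding theorem** (registrar shape: the ONLY theorem of this file whose result type is the rung decl by
name; `assembly_of_quantitative` states the rung's body verbatim so that it is not a second candidate): the rung from the LANDED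
S0⁺ `KrwLrb.stub_jointSubspaceHard` (p715652, `c = 3`) and `lrxQuantitative_holds` (which rests on the two registered stubs
`stub_crossingAlice` / `stub_crossingBob` through `invAt_pad_of_lrx`). -/
theorem StrongCompositionLRX_of : StrongCompositionLRX :=
  assembly_of_quantitative Summit.PneNP.PneNP.Theorems.KrwLrb.stub_jointSubspaceHard lrxQuantitative_holds

end Assembly

/-! ## §8 Links: C1 ⟹ rung C1|LRX ⟹ rung C1|LRB (landed) ⟹ rung C1|LRAD (landed) -/

section Links

variable {m n : ℕ}

/-- C1 implies its `LRX_t` relaxation (ignore the class hypothesis; `+ t` only weakens): a refutation of the rung would refute C1. -/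
theorem lrx_of_strongComposition :
    Theses.KrwChromaticSteering.StrongComposition → StrongCompositionLRX := by
  rintro ⟨c, h⟩
  refine ⟨c, fun m n hn f hf => ?_⟩
  obtain ⟨g, hg⟩ := h m n hn f hf
  refine ⟨g, fun t P _ hP => ?_⟩
  obtain ⟨Q, hQ, hd⟩ := hg P hP
  exact ⟨Q, hQ, by omega⟩

/-- The rung at budget `0` is the landed rung C1|LRB (`KrwLrb.StrongCompositionLRB`; `LRBDisciplined g P` is `LRXDisciplined g 0 P`
by definition). -/
theorem strongCompositionLRB_of_rung (h : StrongCompositionLRX) :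
    Summit.PneNP.PneNP.Theorems.KrwLrb.StrongCompositionLRB := by
  obtain ⟨c, hc⟩ := h
  refine ⟨c, fun m n hn f hf => ?_⟩
  obtain ⟨g, hg⟩ := hc m n hn f hf
  refine ⟨g, fun P hP hsol => ?_⟩
  simpa using hg 0 P hP hsol

/-- … and hence the landed rung C1|LRAD (`KrwLrad.StrongCompositionLRAD`, via `KrwLrb.strongCompositionLRAD_of_LRB`). -/
theorem strongCompositionLRAD_of_rung (h : StrongCompositionLRX) : StrongCompositionLRAD :=
  strongCompositionLRAD_of_LRB (strongCompositionLRB_of_rung h)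

/-- Budget monotonicity `LRX_t ⊆ LRX_{t'}` (`t ≤ t'`) below any typing [adapted from the planner's `P4g20X.lrxOn_mono`]. -/
theorem lrxOn_mono (g : (Fin n → Bool) → Bool) :
    ∀ (P : KWTree (Fin m × Fin n)) (t t' : ℕ) (σ : Fin m → RowTypeX), t ≤ t' →
      LRXDisciplinedOn g t σ P → LRXDisciplinedOn g t' σ P
  | .leaf _, _, _, _, _, _ => trivial
  | .alice _ P Q, t, t', σ, htt, h => by
    obtain ⟨σ', w, hnode, hw, hP, hQ⟩ := h
    exact ⟨σ', w, hnode, hw.trans htt, lrxOn_mono g P _ _ σ' (by omega) hP, lrxOn_mono g Q _ _ σ' (by omega) hQ⟩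
  | .bob _ P Q, t, t', σ, htt, h => by
    obtain ⟨σ', w, hnode, hw, hP, hQ⟩ := h
    exact ⟨σ', w, hnode, hw.trans htt, lrxOn_mono g P _ _ σ' (by omega) hP, lrxOn_mono g Q _ _ σ' (by omega) hQ⟩

/-- `LRB ⊆ LRX_t` for every `t`. -/
theorem lrx_of_lrb {g : (Fin n → Bool) → Bool} {P : KWTree (Fin m × Fin n)} (h : LRBDisciplined g P) (t : ℕ) :
    LRXDisciplined g t P :=
  lrxOn_mono g P 0 t _ (Nat.zero_le t) h

end Links

/-! ## §9 Non-vacuity: independent play is in every `LRX_t` (it is LRB, landed `KrwLrb.lrb_compose`), so inside each class the rung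
is matched from above up to its `O(log mn) + t` loss; and `LRX_1 \ LRX_0`-typings exist (a single-row test followed by an affine test
through that row is a legal `LRX_1` path). -/

section NonVacuity

variable {m n : ℕ}

/-- **Independent play is `LRX_t`** for every budget `t`. -/
theorem lrx_compose (g : (Fin n → Bool) → Bool) (R : KWTree (Fin n)) (Q : KWTree (Fin m)) (t : ℕ) :
    LRXDisciplined g t (KWTree.compose g R Q) :=
  lrx_of_lrb (Summit.PneNP.PneNP.Theorems.KrwLrb.lrb_compose g R Q) t

/-- From any `KW_f` protocol `Q` and `KW_g` protocol `R`, an `LRX_t` protocol for the strong game of depth `Q.depth + R.depth + 1`. -/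
theorem exists_lrx_solvesStrong {f : (Fin m → Bool) → Bool} {g : (Fin n → Bool) → Bool}
    {Q : KWTree (Fin m)} {R : KWTree (Fin n)} (hQ : Q.Solves f) (hR : R.Solves g) (t : ℕ) :
    ∃ P : KWTree (Fin m × Fin n), LRXDisciplined g t P ∧ P.SolvesStrong f g ∧
      P.depth = Q.depth + R.depth + 1 :=
  ⟨KWTree.compose g R Q, lrx_compose g R Q t, KWTree.solvesStrong_compose hQ hR, KWTree.depth_compose g R Q⟩

/-- A genuine type-A path: a single-row test on row `i` (making it combinatorial) followed by the affine test on the single entry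
`(i, j)` — crossing weight `1` — is `LRX_1`-disciplined from the all-fresh typing (with the typing that records the row test as a
row test). -/
theorem lrx_one_rowThenAffine (g : (Fin n → Bool) → Bool) (i : Fin m) (j : Fin n) (ψ : (Fin n → Bool) → Bool)
    (L₁ L₂ L₃ : Fin m × Fin n) :
    LRXDisciplined g 1
      (KWTree.alice (fun X => ψ (row X i))
        (KWTree.bob (fun Y => Y (i, j)) (KWTree.leaf L₁) (KWTree.leaf L₂)) (KWTree.leaf L₃)) := by
  refine ⟨Function.update (fun _ => RowTypeX.fresh) i RowTypeX.combinatorial, 0,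
    Or.inr (Or.inr ⟨i, ψ, fun X => rfl, rfl, rfl⟩), Nat.zero_le _, ?_, trivial⟩
  refine ⟨retagX {(i, j)} (Function.update (fun _ => RowTypeX.fresh) i RowTypeX.combinatorial), 1,
    Or.inr (Or.inl ⟨{(i, j)}, false, fun Y => by simp, rfl, ?_⟩), le_rfl, trivial, trivial⟩
  unfold affWeight
  rw [eq_comm, Finset.card_eq_one]
  refine ⟨i, ?_⟩
  ext i'
  simp [eqRows, Finset.mem_filter, Function.update_apply]

end NonVacuity

end Summit.PneNP.PneNP.Cruxes.StrongComposition.LrxGluing
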